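import Summits.QuantumFields.BalabanUV.Beta.FP.SymDressingUnits
import Summits.QuantumFields.BalabanUV.Beta.SymmetrisedDressingDress

/-!
# `BalabanUV.Beta.FP.SymJetDressingUnits` — road «FP» for binder row D1, ruling R-FP-40 (A) row #21 «TAB-SYM-UNITS» (`AXIAL-VS-SYM.md` v1.1 §4 (A6),
# `RESIDUAL-FP.md` §10 addendum): THE (0.4) JET DRESSING `S ↦ Π̂ (Π̂ᵀ_bond S) Π̂ᵀ`, `W ↦ Π̂ W Π̂ᵀ` (an2 `SymmetrisedDressingDress.dressSymAt`: `.S = dressKSymAt ∘ coProjSymAtK ∘ S⁰`,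
# `.W = dressKSymAt ∘ W⁰`) COMMUTES WITH asym1's JET UNITS `unitS`∕`unitW`, IS ADDITIVE, AND CARRIES `LocStencil`∕`VertexFamily₂` RATE DATA WITH EXPLICIT CONSTANTS — so,
# in the «LEFT» placement of record (undressed leg and columns `KPerf`, DRESSED jets), the literal's perfect jets `S^s`, `W^s` ARE the dressings of the undressed
# constructed limits whenever those limits come with rate data (modulo the (CONV-C) rates of binder row G-an2-4 — an HYPOTHESIS here, as everywhere in road FP)

HONEST DEPENDENCY (page 1, mandatory): continuum YM on T⁴ ⇐ BetaPertH ∧ nine spine estimates (0/9 proved); BetaPertH ⇐ (D1) ∧ (D4) ∧ CAP+tail;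
G-an2-4 gates asym, D1 and NE2/3/4.  HONEST FRAMING (cell contract, verbatim): «discharging `BetaPertH` makes Bałaban's UV stability UNCONDITIONAL —
a real constructive-QFT result; it is NOT the continuum limit and NOT the Clay problem.»  THIS MODULE DISCHARGES NOTHING of the wall: [folklore] kernel
algebra (the block-diagonal `piKSymBm` commutes with leg-type-constant units — part 16's `comp_trK_scaleK_comp_of_comm`; the bond-slot window `coProjSymAtK` is a
finite sum, hence linear; tame bilinearity of `comp`) + an2's `locStencil_coProjSymAtK`∕`locStencil_dressKSymAt`∕`biLoc_dressKSymAt` and asym1's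
`limStOf_eq_of_rate`∕`limTabOf_eq_of_rate` BY NAME.  No `def`, no `def … : Prop`, nothing cited, 0 sorry; 0∕4 row-D1 binders; NOT (CONV-C), NOT (ASYMP), NOT D1,
NOT BetaPertH, NOT continuum, NOT Clay.  «not in print; our bookkeeping».
ABSOLUTE RULE (cell charter, verbatim): «No internally-minted statement may enter as a cited fact. Every hypothesis is either kernel-proved in this package or a
verbatim quotation of a PUBLISHED theorem with page reference. The manuscript(s) under audit are NOT citable for their own disputed steps — they are the thing
under adjudication; programme-internal (2001/route/tribunal) claims are never citable.»

WHAT.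
* §1 [folklore] `comp_smul_left`∕`comp_smul_right` (unconditional), `coProjSymAtK_smul_scaleK` (the bond-slot window commutes with scalars and fibre weights), `coProjSymAtK_sub`;
  `dressKSymAt_scaleK` (`Π̂ (D W D) Π̂ᵀ = D (Π̂ W Π̂ᵀ) D` for `D = legScale sf sm`), `dressKSymAt_smul`, `dressKSymAt_sub` (localised `W`, `W′`; in-block root).
* §2 [folklore] **`unitW_dressSym`**: `unitW sf sm (Π̂ W Π̂ᵀ) = Π̂ (unitW sf sm W) Π̂ᵀ`; **`unitS_dressSym`**: `unitS sf sm (Π̂ (Π̂ᵀ_bond S) Π̂ᵀ) = Π̂ (Π̂ᵀ_bond (unitS sf sm S)) Π̂ᵀ`.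
* §3 [folklore] **`locStencil_dressSym_sub`**: `LocStencil (S − S′) c δ ⟹ LocStencil (dress S − dress S′) (cKb·cKb·cKb′·c) δ` (localised members); **`vertexFamily₂_dressSym_sub`** likewise
  with `cKb·cKb`; hence **`limStOf_dressSym_eq`** ∕ **`limTabOf_dressSym_eq`**: rate data `S j → S∞` (resp. `W j → W∞`) ⟹ the constructed limit of the dressed family IS the dressed
  limit (`0 ≤ θ < 1`); and the unit-rescaled forms **`limStOf_dressSym_unitS_eq`** ∕ **`limTabOf_dressSym_unitW_eq`** (rate data for `unitS (sf j) (sm j) (S j) → S∞` ⟹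
  `limStOf (j ↦ unitS (sf j) (sm j) (dress (S j))) = dress S∞`, and the same for tables) — the shapes road FP's `SPerfOf`∕`WPerfOf` (`PerfectObjectsT`) have at `m = 1`.
Provenance: road FP OWNER b2b-balaban-beta-d1-p3 gen 10 (prover-b2b-balaban-beta-d1-p3-g10-0), 2026-08-21, R-FP-40 (A) row #21.
-/

noncomputable section

namespace Summit.QuantumFields.BalabanUV.Beta.FP.SymJetDressingUnits

open Finset Filter
open scoped BigOperators
open Literature.MathematicalPhysics.QuantumFieldTheory.Balaban1983to89
open Literature.MathematicalPhysics.QuantumFieldTheory.Balaban1983to89.Beta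
open ExpKernelCalculus (MKer Decays BiLoc VertexFamily₂ comp)
open HessKerRate (scaleK scaleK_apply)
open OneStepResolventKernel (Fib LocStencil)
open AffineAveraging (box toSite)
open HessKerDressedLimit (limMKerOf limStOf limTabOf limStOf_eq_of_rate limTabOf_eq_of_rate)
open Summit.QuantumFields.BalabanUV.Beta.TameKernelCalculus
open Summit.QuantumFields.BalabanUV.Beta.HessKerDressedUnits (legScale unitS unitW counitK)
open Summit.QuantumFields.BalabanUV.Beta.AxialDressingRooted (cKb cKb')
open Summit.QuantumFields.BalabanUV.Beta.SymmetrisedDressingKernel (piKSymBm dressKSymAt decays_piKSymBm)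
open Summit.QuantumFields.BalabanUV.Beta.SymmetrisedDressingLegs (coProjSymAt coProjSymAt_apply biLoc_dressKSymAt)
open Summit.QuantumFields.BalabanUV.Beta.SymmetrisedDressingDress (coProjSymAtK coProjSymAtK_eval locStencil_coProjSymAtK locStencil_dressKSymAt)
open Summit.QuantumFields.BalabanUV.Beta.FP.SymDressingUnits (comp_trK_scaleK_comp_of_comm legScale_comm_piKSymBm)

variable {d : ℕ}

/-! ## §1 Linearity of the two dressing operations; the fibre units pass through -/

section Linear

/-- [folklore] `comp` is homogeneous in the left factor (unconditional). -/
theorem comp_smul_left {D : ℕ} {F : Type*} [Fintype F] (c : ℝ) (A K : MKer D F) : comp (c • A) K = c • comp A K := by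
  funext x y a b
  simp only [ExpKernelCalculus.comp, Pi.smul_apply, smul_eq_mul]
  rw [← tsum_mul_left]
  refine tsum_congr fun z => ?_
  rw [Finset.mul_sum]
  exact Finset.sum_congr rfl fun f _ => by ring

/-- [folklore] `comp` is homogeneous in the right factor (unconditional). -/
theorem comp_smul_right {D : ℕ} {F : Type*} [Fintype F] (c : ℝ) (A K : MKer D F) : comp A (c • K) = c • comp A K := by
  funext x y a b
  simp only [ExpKernelCalculus.comp, Pi.smul_apply, smul_eq_mul]
  rw [← tsum_mul_left]
  refine tsum_congr fun z => ?_
  rw [Finset.mul_sum]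
  exact Finset.sum_congr rfl fun f _ => by ring

/-- [folklore] **THE BOND-SLOT WINDOW COMMUTES WITH SCALARS AND FIBRE WEIGHTS** (it is a finite sum over the window, acting on the bond slot only). -/
theorem coProjSymAtK_smul_scaleK (ρ : Fin (d + 1) → ℤ) (N : ℕ) (c : ℝ) (u v : Fib d → ℝ)
    (S : Fin (d + 1) → (Fin (d + 1) → ℤ) → MKer (d + 1) (Fib d)) :
    coProjSymAtK ρ N (fun κ w => c • scaleK u v (S κ w)) = fun κ w => c • scaleK u v (coProjSymAtK ρ N S κ w) := by
  funext κ w x y a b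
  simp only [coProjSymAtK_eval, Pi.smul_apply, smul_eq_mul, scaleK_apply, coProjSymAt_apply, Finset.mul_sum, Finset.sum_mul]
  exact Finset.sum_congr rfl fun v _ => Finset.sum_congr rfl fun β _ => by ring

/-- [folklore] The bond-slot window is additive (finite sum). -/
theorem coProjSymAtK_sub (ρ : Fin (d + 1) → ℤ) (N : ℕ) (S S' : Fin (d + 1) → (Fin (d + 1) → ℤ) → MKer (d + 1) (Fib d)) :
    coProjSymAtK ρ N (S - S') = coProjSymAtK ρ N S - coProjSymAtK ρ N S' := by
  funext κ w x y a b
  simp only [coProjSymAtK_eval, Pi.sub_apply, coProjSymAt_apply, mul_sub, Finset.sum_sub_distrib]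

/-- [folklore] **THE BLOCK-MEAN DRESSING COMMUTES WITH THE LEG UNITS**: `Π̂ (D W D) Π̂ᵀ = D (Π̂ W Π̂ᵀ) D`, `D = legScale sf sm`
(part 16's `comp_trK_scaleK_comp_of_comm` at `P := Π̂ᵀ`). -/
theorem dressKSymAt_scaleK (ρ : Fin (d + 1) → ℤ) (N : ℕ) (sf sm : ℝ) (W : MKer (d + 1) (Fib d)) :
    dressKSymAt ρ N (scaleK (legScale sf sm) (legScale sf sm) W) = scaleK (legScale sf sm) (legScale sf sm) (dressKSymAt ρ N W) := by
  have hP : ∀ x y a b, legScale (d := d) sf sm a * trK (piKSymBm ρ N) x y a b = trK (piKSymBm ρ N) x y a b * legScale sf sm b := by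
    intro x y a b
    show legScale sf sm a * piKSymBm ρ N y x b a = piKSymBm ρ N y x b a * legScale sf sm b
    have h := legScale_comm_piKSymBm ρ N sf sm y x b a
    rw [mul_comm (legScale sf sm a), ← h, mul_comm]
  exact comp_trK_scaleK_comp_of_comm hP W

/-- [folklore] The block-mean dressing is homogeneous. -/
theorem dressKSymAt_smul (ρ : Fin (d + 1) → ℤ) (N : ℕ) (c : ℝ) (W : MKer (d + 1) (Fib d)) :
    dressKSymAt ρ N (c • W) = c • dressKSymAt ρ N W := by
  show comp (comp (piKSymBm ρ N) (c • W)) (trK (piKSymBm ρ N)) = c • comp (comp (piKSymBm ρ N) W) (trK (piKSymBm ρ N))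
  rw [comp_smul_right, comp_smul_left]

/-- [folklore] **THE BLOCK-MEAN DRESSING IS ADDITIVE** on localised kernels (in-block root). -/
theorem dressKSymAt_sub {N : ℕ} (hN : 1 ≤ N) {r : Fin (d + 1) → ℕ} (hr : r ∈ box (d + 1) N) {W W' : MKer (d + 1) (Fib d)}
    (hW : Loc W) (hW' : Loc W') :
    dressKSymAt (toSite r) N (W - W') = dressKSymAt (toSite r) N W - dressKSymAt (toSite r) N W' := by
  have sP : Spr (piKSymBm (toSite r) N) := ⟨_, 1, one_pos, decays_piKSymBm hN hr zero_le_one⟩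
  have sPt : Spr (trK (piKSymBm (toSite r) N)) := sP.trK
  show comp (comp (piKSymBm (toSite r) N) (W - W')) (trK (piKSymBm (toSite r) N)) =
    comp (comp (piKSymBm (toSite r) N) W) (trK (piKSymBm (toSite r) N)) - comp (comp (piKSymBm (toSite r) N) W') (trK (piKSymBm (toSite r) N))
  rw [comp_sub_right_tame sP.tame hW.tame hW'.tame, comp_sub_left_tame (sP.comp_loc hW).tame (sP.comp_loc hW').tame sPt.tame]

end Linear

/-! ## §2 The jet units pass through the (0.4) jet dressing -/

section Units

/-- [folklore] **SECOND-ORDER TABLES**: `unitW sf sm (Π̂ W Π̂ᵀ) = Π̂ (unitW sf sm W) Π̂ᵀ` (member by member). -/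
theorem unitW_dressSym (ρ : Fin (d + 1) → ℤ) (N : ℕ) (sf sm : ℝ)
    (W : Fin (d + 1) → (Fin (d + 1) → ℤ) → Fin (d + 1) → (Fin (d + 1) → ℤ) → MKer (d + 1) (Fib d)) :
    unitW sf sm (fun μ y ν y' => dressKSymAt ρ N (W μ y ν y')) = fun μ y ν y' => dressKSymAt ρ N (unitW sf sm W μ y ν y') := by
  funext μ y ν y'
  show counitK sf sm (dressKSymAt ρ N (W μ y ν y')) = dressKSymAt ρ N (counitK sf sm (W μ y ν y'))
  unfold counitK
  exact (dressKSymAt_scaleK ρ N sf⁻¹ sm⁻¹ (W μ y ν y')).symm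

/-- [folklore] **FIRST-ORDER STENCILS**: `unitS sf sm (Π̂ (Π̂ᵀ_bond S) Π̂ᵀ) = Π̂ (Π̂ᵀ_bond (unitS sf sm S)) Π̂ᵀ` — the scalar `(sf·sm)⁻¹` and the contragredient fibre
weights pass through both dressing operations. -/
theorem unitS_dressSym (ρ : Fin (d + 1) → ℤ) (N : ℕ) (sf sm : ℝ) (S : Fin (d + 1) → (Fin (d + 1) → ℤ) → MKer (d + 1) (Fib d)) :
    unitS sf sm (fun κ u => dressKSymAt ρ N (coProjSymAtK ρ N S κ u)) = fun κ u => dressKSymAt ρ N (coProjSymAtK ρ N (unitS sf sm S) κ u) := by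
  funext κ u
  show (sf * sm)⁻¹ • counitK sf sm (dressKSymAt ρ N (coProjSymAtK ρ N S κ u)) = _
  unfold counitK
  rw [← dressKSymAt_scaleK, ← dressKSymAt_smul]
  congr 1
  have h := congrFun (congrFun (coProjSymAtK_smul_scaleK ρ N (sf * sm)⁻¹ (legScale sf⁻¹ sm⁻¹) (legScale sf⁻¹ sm⁻¹) S) κ) u
  rw [← h]
  rfl

end Units

/-! ## §3 Rate data passes through; the dressed limit IS the limit of the dressed family -/

section Limit

variable {N : ℕ} {r : Fin (d + 1) → ℕ}

/-- [folklore] **STENCIL RATE TRANSFER**: `LocStencil (S − S′) c δ ⟹ LocStencil (dress S − dress S′) (cKb·(cKb·(cKb′·c))) δ` (members localised so that the dressing is additive). -/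
theorem locStencil_dressSym_sub (hN : 1 ≤ N) (hr : r ∈ box (d + 1) N) {S S' : Fin (d + 1) → (Fin (d + 1) → ℤ) → MKer (d + 1) (Fib d)}
    {Cs Cs' δs δs' c δ : ℝ} (hS : LocStencil S Cs δs) (hδs : 0 < δs) (hS' : LocStencil S' Cs' δs') (hδs' : 0 < δs')
    (h : LocStencil (S - S') c δ) (hδ : 0 ≤ δ) :
    LocStencil ((fun κ u => dressKSymAt (toSite r) N (coProjSymAtK (toSite r) N S κ u))
        - fun κ u => dressKSymAt (toSite r) N (coProjSymAtK (toSite r) N S' κ u))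
      (cKb d N δ * (cKb d N δ * (cKb' d N δ * c))) δ := by
  have hl : ∀ κ u, Loc (coProjSymAtK (toSite r) N S κ u) := fun κ u =>
    ⟨u, u, _, δs, hδs, locStencil_coProjSymAtK hN hr hS hδs.le κ u⟩
  have hl' : ∀ κ u, Loc (coProjSymAtK (toSite r) N S' κ u) := fun κ u =>
    ⟨u, u, _, δs', hδs', locStencil_coProjSymAtK hN hr hS' hδs'.le κ u⟩
  have heq : ((fun κ u => dressKSymAt (toSite r) N (coProjSymAtK (toSite r) N S κ u))
      - fun κ u => dressKSymAt (toSite r) N (coProjSymAtK (toSite r) N S' κ u))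
      = fun κ u => dressKSymAt (toSite r) N (coProjSymAtK (toSite r) N (S - S') κ u) := by
    funext κ u
    rw [Pi.sub_apply, Pi.sub_apply, ← dressKSymAt_sub hN hr (hl κ u) (hl' κ u), coProjSymAtK_sub, Pi.sub_apply, Pi.sub_apply]
  rw [heq]
  exact locStencil_dressKSymAt hN hr (locStencil_coProjSymAtK hN hr h hδ) hδ

/-- [folklore] **TABLE RATE TRANSFER**: `VertexFamily₂ (W − W′) M c δ ⟹ VertexFamily₂ (Π̂WΠ̂ᵀ − Π̂W′Π̂ᵀ) M (cKb·(cKb·c)) δ` (members localised). -/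
theorem vertexFamily₂_dressSym_sub (hN : 1 ≤ N) (hr : r ∈ box (d + 1) N) {M : ℕ}
    {W W' : Fin (d + 1) → (Fin (d + 1) → ℤ) → Fin (d + 1) → (Fin (d + 1) → ℤ) → MKer (d + 1) (Fib d)} {Cw Cw' δw δw' c δ : ℝ}
    (hW : VertexFamily₂ W M Cw δw) (hδw : 0 < δw) (hW' : VertexFamily₂ W' M Cw' δw') (hδw' : 0 < δw')
    (h : VertexFamily₂ (W - W') M c δ) (hδ : 0 ≤ δ) :
    VertexFamily₂ ((fun μ y ν y' => dressKSymAt (toSite r) N (W μ y ν y')) - fun μ y ν y' => dressKSymAt (toSite r) N (W' μ y ν y'))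
      M (cKb d N δ * (cKb d N δ * c)) δ := by
  intro μ y ν y'
  have hl : Loc (W μ y ν y') := ⟨_, _, _, δw, hδw, hW μ y ν y'⟩
  have hl' : Loc (W' μ y ν y') := ⟨_, _, _, δw', hδw', hW' μ y ν y'⟩
  have heq : ((fun μ y ν y' => dressKSymAt (toSite r) N (W μ y ν y')) - fun μ y ν y' => dressKSymAt (toSite r) N (W' μ y ν y')) μ y ν y'
      = dressKSymAt (toSite r) N ((W - W') μ y ν y') := by
    simp only [Pi.sub_apply]
    exact (dressKSymAt_sub hN hr hl hl').symm
  rw [heq]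
  exact biLoc_dressKSymAt hN hr (h μ y ν y') hδ

/-- [folklore] **THE DRESSED LIMIT STENCILS ARE THE LIMIT OF THE DRESSED STENCILS** (`0 ≤ θ < 1`): rate data `LocStencil (S j − S∞) (c θ^j) δ` ⟹
`limStOf (j ↦ dress (S j)) = dress S∞`. -/
theorem limStOf_dressSym_eq (hN : 1 ≤ N) (hr : r ∈ box (d + 1) N) {S : ℕ → Fin (d + 1) → (Fin (d + 1) → ℤ) → MKer (d + 1) (Fib d)}
    {Sinf : Fin (d + 1) → (Fin (d + 1) → ℤ) → MKer (d + 1) (Fib d)} {Cs δs Csi δsi c δ θ : ℝ}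
    (hS : ∀ j, LocStencil (S j) Cs δs) (hδs : 0 < δs) (hSi : LocStencil Sinf Csi δsi) (hδsi : 0 < δsi)
    (h : ∀ j, LocStencil (S j - Sinf) (c * θ ^ j) δ) (hδ : 0 ≤ δ) (hθ0 : 0 ≤ θ) (hθ1 : θ < 1) :
    limStOf (fun j κ u => dressKSymAt (toSite r) N (coProjSymAtK (toSite r) N (S j) κ u))
      = fun κ u => dressKSymAt (toSite r) N (coProjSymAtK (toSite r) N Sinf κ u) := by
  refine limStOf_eq_of_rate (c := cKb d N δ * (cKb d N δ * (cKb' d N δ * c))) (δ := δ) (fun k => ?_) hθ0 hθ1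
  have e : cKb d N δ * (cKb d N δ * (cKb' d N δ * (c * θ ^ k))) = cKb d N δ * (cKb d N δ * (cKb' d N δ * c)) * θ ^ k := by ring
  have := locStencil_dressSym_sub hN hr (hS k) hδs hSi hδsi (h k) hδ
  rw [e] at this
  exact this

/-- [folklore] **THE DRESSED LIMIT TABLES ARE THE LIMIT OF THE DRESSED TABLES** (`0 ≤ θ < 1`). -/
theorem limTabOf_dressSym_eq (hN : 1 ≤ N) (hr : r ∈ box (d + 1) N) {M : ℕ}
    {W : ℕ → Fin (d + 1) → (Fin (d + 1) → ℤ) → Fin (d + 1) → (Fin (d + 1) → ℤ) → MKer (d + 1) (Fib d)}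
    {Winf : Fin (d + 1) → (Fin (d + 1) → ℤ) → Fin (d + 1) → (Fin (d + 1) → ℤ) → MKer (d + 1) (Fib d)} {Cw δw Cwi δwi c δ θ : ℝ}
    (hW : ∀ j, VertexFamily₂ (W j) M Cw δw) (hδw : 0 < δw) (hWi : VertexFamily₂ Winf M Cwi δwi) (hδwi : 0 < δwi)
    (h : ∀ j, VertexFamily₂ (W j - Winf) M (c * θ ^ j) δ) (hδ : 0 ≤ δ) (hθ0 : 0 ≤ θ) (hθ1 : θ < 1) :
    limTabOf (fun j μ y ν y' => dressKSymAt (toSite r) N (W j μ y ν y')) = fun μ y ν y' => dressKSymAt (toSite r) N (Winf μ y ν y') := by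
  refine limTabOf_eq_of_rate (N := M) (c := cKb d N δ * (cKb d N δ * c)) (δ := δ) (fun k => ?_) hθ0 hθ1
  have e : cKb d N δ * (cKb d N δ * (c * θ ^ k)) = cKb d N δ * (cKb d N δ * c) * θ ^ k := by ring
  have := vertexFamily₂_dressSym_sub hN hr (hW k) hδw hWi hδwi (h k) hδ
  rw [e] at this
  exact this

/-- [folklore] **UNIT-RESCALED STENCILS** (the shape of road FP's `SPerfOf sf sm … 1 = limStOf (j ↦ unitS (sf j) (sm j) (S j 1))`): rate data for the
unit-rescaled UNDRESSED stencils `unitS (sf j) (sm j) (S j) → S∞` ⟹ `limStOf (j ↦ unitS (sf j) (sm j) (dress (S j))) = dress S∞` (`unitS_dressSym`). -/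
theorem limStOf_dressSym_unitS_eq (hN : 1 ≤ N) (hr : r ∈ box (d + 1) N) (sf sm : ℕ → ℝ)
    {S : ℕ → Fin (d + 1) → (Fin (d + 1) → ℤ) → MKer (d + 1) (Fib d)} {Sinf : Fin (d + 1) → (Fin (d + 1) → ℤ) → MKer (d + 1) (Fib d)}
    {Cs δs Csi δsi c δ θ : ℝ} (hS : ∀ j, LocStencil (unitS (sf j) (sm j) (S j)) Cs δs) (hδs : 0 < δs) (hSi : LocStencil Sinf Csi δsi) (hδsi : 0 < δsi)
    (h : ∀ j, LocStencil (unitS (sf j) (sm j) (S j) - Sinf) (c * θ ^ j) δ) (hδ : 0 ≤ δ) (hθ0 : 0 ≤ θ) (hθ1 : θ < 1) :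
    limStOf (fun j => unitS (sf j) (sm j) (fun κ u => dressKSymAt (toSite r) N (coProjSymAtK (toSite r) N (S j) κ u)))
      = fun κ u => dressKSymAt (toSite r) N (coProjSymAtK (toSite r) N Sinf κ u) := by
  have hfam : (fun j => unitS (sf j) (sm j) (fun κ u => dressKSymAt (toSite r) N (coProjSymAtK (toSite r) N (S j) κ u)))
      = fun j κ u => dressKSymAt (toSite r) N (coProjSymAtK (toSite r) N (unitS (sf j) (sm j) (S j)) κ u) :=
    funext fun j => unitS_dressSym (toSite r) N (sf j) (sm j) (S j)
  rw [hfam]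
  exact limStOf_dressSym_eq hN hr hS hδs hSi hδsi h hδ hθ0 hθ1

/-- [folklore] **UNIT-RESCALED TABLES** (the shape of `WPerfOf sf sm … 1`): rate data for `unitW (sf j) (sm j) (W j) → W∞` ⟹
`limTabOf (j ↦ unitW (sf j) (sm j) (Π̂ (W j) Π̂ᵀ)) = Π̂ W∞ Π̂ᵀ` (`unitW_dressSym`). -/
theorem limTabOf_dressSym_unitW_eq (hN : 1 ≤ N) (hr : r ∈ box (d + 1) N) {M : ℕ} (sf sm : ℕ → ℝ)
    {W : ℕ → Fin (d + 1) → (Fin (d + 1) → ℤ) → Fin (d + 1) → (Fin (d + 1) → ℤ) → MKer (d + 1) (Fib d)}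
    {Winf : Fin (d + 1) → (Fin (d + 1) → ℤ) → Fin (d + 1) → (Fin (d + 1) → ℤ) → MKer (d + 1) (Fib d)} {Cw δw Cwi δwi c δ θ : ℝ}
    (hW : ∀ j, VertexFamily₂ (unitW (sf j) (sm j) (W j)) M Cw δw) (hδw : 0 < δw) (hWi : VertexFamily₂ Winf M Cwi δwi) (hδwi : 0 < δwi)
    (h : ∀ j, VertexFamily₂ (unitW (sf j) (sm j) (W j) - Winf) M (c * θ ^ j) δ) (hδ : 0 ≤ δ) (hθ0 : 0 ≤ θ) (hθ1 : θ < 1) :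
    limTabOf (fun j => unitW (sf j) (sm j) (fun μ y ν y' => dressKSymAt (toSite r) N (W j μ y ν y')))
      = fun μ y ν y' => dressKSymAt (toSite r) N (Winf μ y ν y') := by
  have hfam : (fun j => unitW (sf j) (sm j) (fun μ y ν y' => dressKSymAt (toSite r) N (W j μ y ν y')))
      = fun j μ y ν y' => dressKSymAt (toSite r) N (unitW (sf j) (sm j) (W j) μ y ν y') :=
    funext fun j => unitW_dressSym (toSite r) N (sf j) (sm j) (W j)
  rw [hfam]
  exact limTabOf_dressSym_eq hN hr hW hδw hWi hδwi h hδ hθ0 hθ1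

end Limit

end Summit.QuantumFields.BalabanUV.Beta.FP.SymJetDressingUnits

end
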